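import Summits.HodgeConjecture.HodgeConjecture.Theorems.R90S4InnerSimilFixesClass     -- ★ p861508 `exists_cmDatumLocalCongr_eq_conj_of_eq_norm_mul` (similitudes in one norm class differ by `Ad(u)`)
import Summits.HodgeConjecture.HodgeConjecture.Theorems.R90S4SimilConjEquivalence    -- ★ p861479 `cmDatumLocalCongr_trans_eq_mul`, `cmDatumLocalCongr_one_eq_refl`, `formCongr_mul_eq_smul_of_eq_smul`
import Literature.NumberTheory.Automorphic.LocalUnitaryGroupCongrInner               -- ★ `conjLocal_eq_self_of_formCongr_eq_smul_antidiag` (a similitude factor is `σ`-fixed)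
import Literature.NumberTheory.Automorphic.LocalUnitaryGroupCongrMeasure             -- ★ `exists_map_eq_smul_of_continuousMulEquiv` (Haar uniqueness along `≃ₜ*`); instances on `(cmDatum …).Local v`
import Literature.Topology.RestrictedProductProdEquiv                               -- ★ `Literature.Topology.ContinuousMulEquiv.prodCongr`
import Summits.HodgeConjecture.HodgeConjecture.Theorems.R90S4HPacketStable           -- ★ p861950 (this seat) the head `isStableFinsetH_of_isRogPacketH` (letters H1–H5)
import Summits.HodgeConjecture.HodgeConjecture.Theorems.F0P3cStCharTSWeylFlipH       -- ★ `map_conj_eq_self` (a bi-invariant measure is `Ad(g)`-invariant)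
import HarnessLib

/-!
# R90-TF · S4 (Rogawski Ch. 13.1–2) — letter (H3) of the S4#B6 road «restriction ∕ similitude»: SIMILITUDE CONJUGATION PRESERVES
# THE HAAR MEASURE of `H_v = U(Φ₂)_v × U(Φ₁)_v`

Cell `hodgecm-mathlib`, crux H413 (`stmt-HodgeConjecture-24833`, lane `--supports … --as helper`), route of record `HCCMUnconditional`
(count-neutral).  Programme R90-TF, section S4 (dealer K2E2-plan (g6)); seat K2E3-p11 (g8); pays letter (H3) `hHaar` of ★∕📤
`Theorems/R90S4HPacketStable.lean` (`isStableFinsetH_of_isRogPacketH`, REPORT-FIRST R90 bus 2026-09-04T16:22:47Z, dealer «=» 16:25:44Z):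
for a local similitude `T` of `Φ₂` (`ᵗT̄ Φ₂ T = a Φ₂`, `a` a unit) and `E_T := Ad(T) × id : H_v ≃ₜ* H_v` (★ `cmDatumLocalCongr`, ★
`ContinuousMulEquiv.prodCongr`), a bi-invariant Haar measure `νH` on `H_v` satisfies `(E_T)_* νH = νH`.

PROOF («the square of an outer similitude is inner»).  By uniqueness of Haar measure `(E_T)_* νH = c • νH` with `0 < c` (★
`exists_map_eq_smul_of_continuousMulEquiv`).  The factor `a` is `σ`-fixed (★ `conjLocal_eq_self_of_formCongr_eq_smul_antidiag`), so
`T²` has multiplier `a² = σ(a) a · 1`, a NORM class of the identity: ★ `exists_cmDatumLocalCongr_eq_conj_of_eq_norm_mul` gives `u ∈ U(Φ₂)_v`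
with `Ad(T²) = Ad(u)`, whence `E_T ∘ E_T = Ad(u, 1)` is INNER and preserves the bi-invariant `νH`; so `c² • νH = νH`, `c² = 1` on a compact
neighbourhood of `1` (positive finite mass), `c = 1`.  [Rogawski1990 §11.1 p. 161 «`PGL₂(F)` acts on `G` by conjugation»; §1.7 p. 6 (Haar
measures); Folland 1995 Thm. 2.20 (uniqueness).]

HONEST LABEL: a ★-closable letter paid; the socket `stub_R90_S4_H_stable` stays OPEN modulo (H1) (H2) (H5) named inputs and (H4); HC_CM is
proved only modulo the 7 printed citations (2 remaining named inputs: hLiu418 = stmt-HodgeConjecture-24832, h413 = stmt-HodgeConjecture-24833)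
until rung 0 closes; REL ≠ ★ ≠ BUILT; count-neutral.

## References
* [Rogawski1990] J. D. Rogawski, *Automorphic Representations of Unitary Groups in Three Variables*, Ann. of Math. Stud. 123 (1990),
  §1.7 p. 6; §3.5 Lemma 3.5.3 p. 28; §11.1 p. 161.
* [Folland1995] G. B. Folland, *A Course in Abstract Harmonic Analysis* (1995), Thm. 2.20 (uniqueness of Haar measure).
* [PlatonovRapinchuk1994] V. Platonov, A. Rapinchuk, *Algebraic Groups and Number Theory* (1994), §2.3, §3.5.
-/

set_option autoImplicit false
set_option linter.dupNamespace false

noncomputable section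

open MeasureTheory NumberField IsDedekindDomain
open scoped Matrix MatrixGroups NNReal ENNReal
open Literature.NumberTheory.Automorphic Literature.NumberTheory.Automorphic.UnitaryGroup

namespace Summit.HodgeConjecture.HodgeConjecture.R90.S4

/-! ## §0 Generic: a Haar scaling whose square is trivial is trivial -/

section Generic

variable {G : Type*} [Group G] [TopologicalSpace G] [IsTopologicalGroup G] [MeasurableSpace G] [BorelSpace G]

variable [LocallyCompactSpace G]

omit [IsTopologicalGroup G] [BorelSpace G] in
/-- **A Haar scaling factor with trivial square is trivial**: if `e_* μ = c • μ` (`c : ℝ≥0`) and `e_* (e_* μ) = μ` for a Haar measure `μ`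
and a measurable group automorphism `e`, then `e_* μ = μ`. [cite: Folland1995, Thm. 2.20] -/
theorem map_eq_self_of_map_eq_smul_of_map_map_eq (μ : Measure G) [μ.IsHaarMeasure] (e : G ≃ₜ* G) {c : ℝ≥0}
    (hc : μ.map e = c • μ) (h2 : (μ.map e).map e = μ) : μ.map e = μ := by
  -- `(c * c) • μ = μ`
  have hsq : (c * c) • μ = μ := by
    calc (c * c) • μ = (μ.map e).map e := by rw [hc, Measure.map_smul, hc, smul_smul]
      _ = μ := h2
  -- evaluate on a compact neighbourhood of `1` (positive finite mass)
  obtain ⟨K, hK, hK1⟩ := exists_compact_mem_nhds (1 : G)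
  have h0 : μ K ≠ 0 := (Measure.measure_pos_of_mem_nhds μ hK1).ne'
  have htop : μ K ≠ ∞ := hK.measure_lt_top.ne
  have hKeq : ((c * c : ℝ≥0) : ℝ≥0∞) * μ K = 1 * μ K := by
    rw [one_mul, ← Measure.coe_nnreal_smul_apply, hsq]
  rw [ENNReal.mul_left_inj h0 htop, ENNReal.coe_eq_one] at hKeq
  have hc1 : c = 1 := by
    have hcc : (c : ℝ) * c = 1 := by exact_mod_cast hKeq
    rcases mul_self_eq_one_iff.1 hcc with h | h
    · exact_mod_cast h
    · exfalso
      have h0c : (0 : ℝ) ≤ c := c.2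
      linarith
  rw [hc, hc1, one_smul]

end Generic

/-! ## §1 `(Ad(T) × id)_* νH = νH` on `H_v = U(Φ₂)_v × U(Φ₁)_v` -/

section CM

variable (L : Type) [Field L] [NumberField L] [IsCMField L] (v : HeightOneSpectrum (𝓞 ↥(maximalRealSubfield L)))

/-- **The square of a similitude conjugation is inner**: for a similitude `T` of `Φ₂` with unit multiplier `a` (so `σ(a) = a`), there is
`u ∈ U(Φ₂)(L⁺_v)` with `Ad(T)(Ad(T) g) = u g u⁻¹` for all `g ∈ U(Φ₂)(L⁺_v)` (`T²` has the NORM multiplier `σ(a) a`).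
[cite: Rogawski1990, §3.5 Lemma 3.5.3 (a) p. 28; §11.1 p. 161] [cite: PlatonovRapinchuk1994, §2.3] -/
theorem exists_cmDatumLocalCongr_sq_eq_conj (T : GL (Fin 2) (LocalRing L v)) {a : LocalRing L v} (ha : IsUnit a)
    (hT : formCongr (conjLocal L (IsCMField.complexConj L) v) T
        ((Matrix.of fun i j : Fin 2 => if i.val + j.val + 1 = 2 then (1 : L) else 0).map (algebraMap L (LocalRing L v))) =
      a • (Matrix.of fun i j : Fin 2 => if i.val + j.val + 1 = 2 then (1 : L) else 0).map (algebraMap L (LocalRing L v))) :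
    ∃ u : (cmDatum L 2 (Matrix.of fun i j : Fin 2 => if i.val + j.val + 1 = 2 then (1 : L) else 0)).Local v,
      ∀ g, cmDatumLocalCongr L v T ha hT (cmDatumLocalCongr L v T ha hT g) = u * g * u⁻¹ := by
  -- `σ(a) = a`
  have hσa : conjLocal L (IsCMField.complexConj L) v a = a :=
    conjLocal_eq_self_of_formCongr_eq_smul_antidiag L (N := 2) two_ne_zero (antidiagOne_isHermitian L 2) v T hT
  -- `T = 1` with multiplier `1`, and `T²` with multiplier `a²`
  have h1 : formCongr (conjLocal L (IsCMField.complexConj L) v) (1 : GL (Fin 2) (LocalRing L v))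
      ((Matrix.of fun i j : Fin 2 => if i.val + j.val + 1 = 2 then (1 : L) else 0).map (algebraMap L (LocalRing L v))) =
      (1 : LocalRing L v) • (Matrix.of fun i j : Fin 2 => if i.val + j.val + 1 = 2 then (1 : L) else 0).map (algebraMap L (LocalRing L v)) := by
    simp [formCongr, Matrix.map_one]
  have hTT := formCongr_mul_eq_smul_of_eq_smul L v T T hT hT
  have hzz : a * a = conjLocal L (IsCMField.complexConj L) v a * a * 1 := by rw [hσa, mul_one]
  obtain ⟨u, hu⟩ := exists_cmDatumLocalCongr_eq_conj_of_eq_norm_mul L v 1 (T * T) isUnit_one (ha.mul ha) h1 hTT ha hzz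
  refine ⟨u, fun g => ?_⟩
  have htr := cmDatumLocalCongr_trans_eq_mul L v T T ha hT ha hT (ha.mul ha) hTT
  have hg := congrArg (fun e : (cmDatum L 2 (Matrix.of fun i j : Fin 2 => if i.val + j.val + 1 = 2 then (1 : L) else 0)).Local v ≃ₜ*
      (cmDatum L 2 (Matrix.of fun i j : Fin 2 => if i.val + j.val + 1 = 2 then (1 : L) else 0)).Local v => e g) htr
  simp only [ContinuousMulEquiv.trans_apply] at hg
  rw [hg, hu g, cmDatumLocalCongr_one_eq_refl, ContinuousMulEquiv.refl_apply]

/-- **LETTER (H3) PAID — similitude conjugation preserves the Haar measure of `H_v`**: for a local similitude `T` of `Φ₂` with unit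
multiplier `a` and a left- and right-invariant Haar measure `νH` on `H_v = U(Φ₂)(L⁺_v) × U(Φ₁)(L⁺_v)`,
`(Ad(T) × id)_* νH = νH` — the hypothesis `hHaar` of ★ `isStableFinsetH_of_isRogPacketH`, TOKEN FOR TOKEN.
[cite: Rogawski1990, §11.1 p. 161; §1.7 p. 6] [cite: Folland1995, Thm. 2.20] -/
theorem map_prodCongr_cmDatumLocalCongr_eq_self
    [MeasurableSpace ((cmDatum L 2 (Matrix.of fun i j : Fin 2 => if i.val + j.val + 1 = 2 then (1 : L) else 0)).Local v ×
      (cmDatum L 1 (Matrix.of fun i j : Fin 1 => if i.val + j.val + 1 = 1 then (1 : L) else 0)).Local v)]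
    [BorelSpace ((cmDatum L 2 (Matrix.of fun i j : Fin 2 => if i.val + j.val + 1 = 2 then (1 : L) else 0)).Local v ×
      (cmDatum L 1 (Matrix.of fun i j : Fin 1 => if i.val + j.val + 1 = 1 then (1 : L) else 0)).Local v)]
    (νH : Measure ((cmDatum L 2 (Matrix.of fun i j : Fin 2 => if i.val + j.val + 1 = 2 then (1 : L) else 0)).Local v ×
      (cmDatum L 1 (Matrix.of fun i j : Fin 1 => if i.val + j.val + 1 = 1 then (1 : L) else 0)).Local v))
    [νH.IsHaarMeasure] [νH.IsMulRightInvariant]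
    (T : GL (Fin 2) (LocalRing L v)) (a : LocalRing L v) (ha : IsUnit a)
    (hT : formCongr (conjLocal L (IsCMField.complexConj L) v) T
        ((Matrix.of fun i j : Fin 2 => if i.val + j.val + 1 = 2 then (1 : L) else 0).map (algebraMap L (LocalRing L v))) =
      a • (Matrix.of fun i j : Fin 2 => if i.val + j.val + 1 = 2 then (1 : L) else 0).map (algebraMap L (LocalRing L v))) :
    νH.map (Literature.Topology.ContinuousMulEquiv.prodCongr (cmDatumLocalCongr L v T ha hT)
      (ContinuousMulEquiv.refl ((cmDatum L 1 (Matrix.of fun i j : Fin 1 => if i.val + j.val + 1 = 1 then (1 : L) else 0)).Local v))) = νH := by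
  set E := Literature.Topology.ContinuousMulEquiv.prodCongr (cmDatumLocalCongr L v T ha hT)
    (ContinuousMulEquiv.refl ((cmDatum L 1 (Matrix.of fun i j : Fin 1 => if i.val + j.val + 1 = 1 then (1 : L) else 0)).Local v))
    with hE
  -- Haar uniqueness: `E_* νH = c • νH`
  obtain ⟨c, -, hc⟩ := exists_map_eq_smul_of_continuousMulEquiv E νH νH
  -- `E ∘ E = Ad(u, 1)` is inner
  obtain ⟨u, hu⟩ := exists_cmDatumLocalCongr_sq_eq_conj L v T ha hT
  have hEE : ∀ x, E (E x) = (u, 1) * x * (u, 1)⁻¹ := by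
    rintro ⟨g, g₁⟩
    refine Prod.ext ?_ ?_
    · simp only [hE, Literature.Topology.ContinuousMulEquiv.prodCongr_apply, Prod.fst_mul, Prod.fst_inv, hu g]
    · simp only [hE, Literature.Topology.ContinuousMulEquiv.prodCongr_apply, ContinuousMulEquiv.refl_apply, Prod.snd_mul,
        Prod.snd_inv, one_mul, inv_one, mul_one]
  have hEm : Measurable (E : _ → _) := E.continuous.measurable
  have h2 : (νH.map E).map E = νH := by
    rw [Measure.map_map hEm hEm]
    have hcomp : ((E : _ → _) ∘ E) = fun x => (u, 1) * x * (u, 1)⁻¹ := funext fun x => hEE x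
    rw [hcomp, Summit.HodgeConjecture.HodgeConjecture.Cruxes.H413.F0P3cStCharTSWeylFlipH.map_conj_eq_self]
  exact map_eq_self_of_map_eq_smul_of_map_map_eq νH E hc h2

/-! ## §2 The head with (H3) discharged: `_stable` from (H1) (H2) (H4) (H5) -/

/-- **S4#B6 road of record, (H3) DISCHARGED**: the head ★ `isStableFinsetH_of_isRogPacketH` fed with §1 — the packet trace of every Rogawski
`H_v`-packet is stable GIVEN the similitude of record `T` with (H2) «stable `G`-regular classes are `{[γ], [E_T γ]}`», (H4) «canonical
`G`-regular orbital integrals are `E_T`-equivariant», (H5) «`G`-regular orbital integrands of test functions are `mH`-integrable» and (H1)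
Harish-Chandra's «`G`-regular orbital integrals determine admissible characters» (the bi-invariance `[νH.IsMulRightInvariant]` of the socket's
Haar measure is now USED). [cite: Rogawski1990, §11.1 p. 161; §3.1 p. 19; §4.1 pp. 39–40; §13.1 Thm. 13.1.1 (2) p. 198] [cite: LabesseLanglands1979, §2] -/
theorem isStableFinsetH_of_isRogPacketH_of_simil
    [MeasurableSpace ((cmDatum L 2 (Matrix.of fun i j : Fin 2 => if i.val + j.val + 1 = 2 then (1 : L) else 0)).Local v ×
      (cmDatum L 1 (Matrix.of fun i j : Fin 1 => if i.val + j.val + 1 = 1 then (1 : L) else 0)).Local v)]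
    [BorelSpace ((cmDatum L 2 (Matrix.of fun i j : Fin 2 => if i.val + j.val + 1 = 2 then (1 : L) else 0)).Local v ×
      (cmDatum L 1 (Matrix.of fun i j : Fin 1 => if i.val + j.val + 1 = 1 then (1 : L) else 0)).Local v)]
    [∀ a : ((cmDatum L 2 (Matrix.of fun i j : Fin 2 => if i.val + j.val + 1 = 2 then (1 : L) else 0)).Local v ×
        (cmDatum L 1 (Matrix.of fun i j : Fin 1 => if i.val + j.val + 1 = 1 then (1 : L) else 0)).Local v),
      MeasurableSpace (((cmDatum L 2 (Matrix.of fun i j : Fin 2 => if i.val + j.val + 1 = 2 then (1 : L) else 0)).Local v ×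
        (cmDatum L 1 (Matrix.of fun i j : Fin 1 => if i.val + j.val + 1 = 1 then (1 : L) else 0)).Local v) ⧸
        Subgroup.centralizer ({a} : Set ((cmDatum L 2 (Matrix.of fun i j : Fin 2 => if i.val + j.val + 1 = 2 then (1 : L) else 0)).Local v ×
        (cmDatum L 1 (Matrix.of fun i j : Fin 1 => if i.val + j.val + 1 = 1 then (1 : L) else 0)).Local v)))]
    (νH : Measure ((cmDatum L 2 (Matrix.of fun i j : Fin 2 => if i.val + j.val + 1 = 2 then (1 : L) else 0)).Local v ×
      (cmDatum L 1 (Matrix.of fun i j : Fin 1 => if i.val + j.val + 1 = 1 then (1 : L) else 0)).Local v))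
    [νH.IsHaarMeasure] [νH.IsMulRightInvariant]
    (mH : OrbitalMeasureFamily ((cmDatum L 2 (Matrix.of fun i j : Fin 2 => if i.val + j.val + 1 = 2 then (1 : L) else 0)).Local v ×
      (cmDatum L 1 (Matrix.of fun i j : Fin 1 => if i.val + j.val + 1 = 1 then (1 : L) else 0)).Local v))
    (T : GL (Fin 2) (LocalRing L v)) (a : LocalRing L v) (ha : IsUnit a)
    (hT : formCongr (conjLocal L (IsCMField.complexConj L) v) T
        ((Matrix.of fun i j : Fin 2 => if i.val + j.val + 1 = 2 then (1 : L) else 0).map (algebraMap L (LocalRing L v))) =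
      a • (Matrix.of fun i j : Fin 2 => if i.val + j.val + 1 = 2 then (1 : L) else 0).map (algebraMap L (LocalRing L v)))
    (hST : ∀ γ : (cmDatum L 2 (Matrix.of fun i j : Fin 2 => if i.val + j.val + 1 = 2 then (1 : L) else 0)).Local v ×
        (cmDatum L 1 (Matrix.of fun i j : Fin 1 => if i.val + j.val + 1 = 1 then (1 : L) else 0)).Local v,
      Literature.NumberTheory.Rogawski1990.IsLocalGRegular L v γ →
        ∀ c : ConjClasses ((cmDatum L 2 (Matrix.of fun i j : Fin 2 => if i.val + j.val + 1 = 2 then (1 : L) else 0)).Local v ×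
          (cmDatum L 1 (Matrix.of fun i j : Fin 1 => if i.val + j.val + 1 = 1 then (1 : L) else 0)).Local v),
        Literature.NumberTheory.Rogawski1990.IsLocalStablyConjH L v γ c.out ↔
          (c = ConjClasses.mk γ ∨
            c = ConjClasses.mk (Literature.Topology.ContinuousMulEquiv.prodCongr (cmDatumLocalCongr L v T ha hT)
              (ContinuousMulEquiv.refl ((cmDatum L 1 (Matrix.of fun i j : Fin 1 => if i.val + j.val + 1 = 1 then (1 : L) else 0)).Local v)) γ)))
    (hOrb : ∀ γ : (cmDatum L 2 (Matrix.of fun i j : Fin 2 => if i.val + j.val + 1 = 2 then (1 : L) else 0)).Local v ×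
        (cmDatum L 1 (Matrix.of fun i j : Fin 1 => if i.val + j.val + 1 = 1 then (1 : L) else 0)).Local v,
      Literature.NumberTheory.Rogawski1990.IsLocalGRegular L v γ →
        ∀ f : (cmDatum L 2 (Matrix.of fun i j : Fin 2 => if i.val + j.val + 1 = 2 then (1 : L) else 0)).Local v ×
          (cmDatum L 1 (Matrix.of fun i j : Fin 1 => if i.val + j.val + 1 = 1 then (1 : L) else 0)).Local v → ℂ,
        Literature.NumberTheory.Rogawski1990.IsLocSmooth f →
        classOrbitalIntegral mH (f ∘ (Literature.Topology.ContinuousMulEquiv.prodCongr (cmDatumLocalCongr L v T ha hT)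
          (ContinuousMulEquiv.refl ((cmDatum L 1 (Matrix.of fun i j : Fin 1 => if i.val + j.val + 1 = 1 then (1 : L) else 0)).Local v))))
          (ConjClasses.mk γ) =
        classOrbitalIntegral mH f (ConjClasses.mk (Literature.Topology.ContinuousMulEquiv.prodCongr (cmDatumLocalCongr L v T ha hT)
          (ContinuousMulEquiv.refl ((cmDatum L 1 (Matrix.of fun i j : Fin 1 => if i.val + j.val + 1 = 1 then (1 : L) else 0)).Local v)) γ)))
    (hInt : ∀ γ : (cmDatum L 2 (Matrix.of fun i j : Fin 2 => if i.val + j.val + 1 = 2 then (1 : L) else 0)).Local v ×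
        (cmDatum L 1 (Matrix.of fun i j : Fin 1 => if i.val + j.val + 1 = 1 then (1 : L) else 0)).Local v,
      Literature.NumberTheory.Rogawski1990.IsLocalGRegular L v γ →
        ∀ f : (cmDatum L 2 (Matrix.of fun i j : Fin 2 => if i.val + j.val + 1 = 2 then (1 : L) else 0)).Local v ×
          (cmDatum L 1 (Matrix.of fun i j : Fin 1 => if i.val + j.val + 1 = 1 then (1 : L) else 0)).Local v → ℂ,
        Literature.NumberTheory.Rogawski1990.IsLocSmooth f →
        Integrable (Literature.MeasureTheory.Group.descConj (Quotient.out (ConjClasses.mk γ))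
          (Subgroup.centralizer ({(Quotient.out (ConjClasses.mk γ) : (cmDatum L 2 (Matrix.of fun i j : Fin 2 => if i.val + j.val + 1 = 2 then (1 : L) else 0)).Local v ×
            (cmDatum L 1 (Matrix.of fun i j : Fin 1 => if i.val + j.val + 1 = 1 then (1 : L) else 0)).Local v)} : Set _))
          (fun _ hg => Subgroup.mem_centralizer_singleton_iff.1 hg) f) (mH (ConjClasses.mk γ)))
    (hHC : ∀ σ : IrrClass ((cmDatum L 2 (Matrix.of fun i j : Fin 2 => if i.val + j.val + 1 = 2 then (1 : L) else 0)).Local v ×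
        (cmDatum L 1 (Matrix.of fun i j : Fin 1 => if i.val + j.val + 1 = 1 then (1 : L) else 0)).Local v), σ.IsAdmissible →
      ∀ f f' : (cmDatum L 2 (Matrix.of fun i j : Fin 2 => if i.val + j.val + 1 = 2 then (1 : L) else 0)).Local v ×
        (cmDatum L 1 (Matrix.of fun i j : Fin 1 => if i.val + j.val + 1 = 1 then (1 : L) else 0)).Local v → ℂ,
        Literature.NumberTheory.Rogawski1990.IsLocSmooth f → Literature.NumberTheory.Rogawski1990.IsLocSmooth f' →
        (∀ γ, Literature.NumberTheory.Rogawski1990.IsLocalGRegular L v γ →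
          classOrbitalIntegral mH f (ConjClasses.mk γ) = classOrbitalIntegral mH f' (ConjClasses.mk γ)) →
        σ.smoothTrace νH f = σ.smoothTrace νH f')
    (S : Finset (IrrClass
      ((cmDatum L 2 (Matrix.of fun i j : Fin 2 => if i.val + j.val + 1 = 2 then (1 : L) else 0)).Local v ×
        (cmDatum L 1 (Matrix.of fun i j : Fin 1 => if i.val + j.val + 1 = 1 then (1 : L) else 0)).Local v)))
    (hS : ∃ (O : Finset (IrrClass ((cmDatum L 2 (Matrix.of fun i j : Fin 2 => if i.val + j.val + 1 = 2 then (1 : L) else 0)).Local v)))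
        (χ : (cmDatum L 1 (Matrix.of fun i j : Fin 1 => if i.val + j.val + 1 = 1 then (1 : L) else 0)).Local v →* ℂˣ)
        (hχ : IsOpen ((χ.ker : Subgroup
            ((cmDatum L 1 (Matrix.of fun i j : Fin 1 => if i.val + j.val + 1 = 1 then (1 : L) else 0)).Local v)) :
          Set ((cmDatum L 1 (Matrix.of fun i j : Fin 1 => if i.val + j.val + 1 = 1 then (1 : L) else 0)).Local v))),
        (∃ σ : IrrClass ((cmDatum L 2 (Matrix.of fun i j : Fin 2 => if i.val + j.val + 1 = 2 then (1 : L) else 0)).Local v),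
          σ.IsAdmissible ∧ ∀ c, c ∈ O ↔
            ∃ (T : GL (Fin 2) (LocalRing L v)) (a : LocalRing L v) (ha : IsUnit a)
              (h : formCongr (conjLocal L (IsCMField.complexConj L) v) T
                ((Matrix.of fun i j : Fin 2 => if i.val + j.val + 1 = 2 then (1 : L) else 0).map (algebraMap L (LocalRing L v))) =
                a • (Matrix.of fun i j : Fin 2 => if i.val + j.val + 1 = 2 then (1 : L) else 0).map (algebraMap L (LocalRing L v))),
              c = IrrClass.comap (cmDatumLocalCongr L v T ha h) σ) ∧
        S = O.map ⟨IrrClass.boxChar χ hχ, IrrClass.boxChar_injective χ hχ⟩) :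
    ∀ fH fH' : ((cmDatum L 2 (Matrix.of fun i j : Fin 2 => if i.val + j.val + 1 = 2 then (1 : L) else 0)).Local v ×
        (cmDatum L 1 (Matrix.of fun i j : Fin 1 => if i.val + j.val + 1 = 1 then (1 : L) else 0)).Local v) → ℂ,
      Literature.NumberTheory.Rogawski1990.IsLocSmooth fH → Literature.NumberTheory.Rogawski1990.IsLocSmooth fH' →
        (∀ γH, Literature.NumberTheory.Rogawski1990.IsLocalGRegular L v γH →
          Literature.NumberTheory.Rogawski1990.stableOrbitalIntegralRel (Literature.NumberTheory.Rogawski1990.IsLocalStablyConjH L v) mH fH γH =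
            Literature.NumberTheory.Rogawski1990.stableOrbitalIntegralRel (Literature.NumberTheory.Rogawski1990.IsLocalStablyConjH L v) mH fH' γH) →
        ∑ σ ∈ S, σ.smoothTrace νH fH = ∑ σ ∈ S, σ.smoothTrace νH fH' :=
  isStableFinsetH_of_isRogPacketH L v νH mH T a ha hT hST (map_prodCongr_cmDatumLocalCongr_eq_self L v νH T a ha hT) hOrb hInt hHC S hS

end CM

end Summit.HodgeConjecture.HodgeConjecture.R90.S4

end
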